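import Mathlib.Data.ZMod.Basic
import Literature.Computability.QuantumComplexity.GaussianRank
import Literature.Computability.QuantumComplexity.DecisionDiagrams

/-!
# `SymplecticPurity.GaussianDegreeBound` (stmt-QuantumAdvantage-9838) — I: Jordan–Wigner words

Helper file (prover, `--supports stmt-QuantumAdvantage-9838`) for the support item
`GaussianDegreeBound` of route SymplecticPurity (purity of an initial block of `d` qubits after a
fermionic Gaussian unitary applied to an `ε`-flat state).  This file is the PAULI-ALGEBRA part of
the proof, over the tree's Jordan–Wigner Majoranas `majorana n j b` (`GaussianRank.lean`) and the
product table of Pauli strings (`pauliString_mul`, `DecisionDiagrams.lean`):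

* `exists_word_of_low` — every Pauli string supported on the wires `< d` is a unit phase times an
  ORDERED PRODUCT (a *word*) of at most `2d` Majoranas (`X_j = Z_{<j} c_{j,X}`,
  `Y_j = Z_{<j} c_{j,Y}`, `Z_j = -i c_{j,X} c_{j,Y}`; induction on `d`, absorbing the `Z`-tail into
  the lower string before the induction hypothesis is applied);
* `word_eq_smul_pauliString` — every Majorana word (repetitions allowed) is a unit phase times the
  Pauli string whose `𝔽₂`-symplectic bits are the SUM of the bits of its letters' Jordan–Wigner
  words (strings form a group modulo phases);
* `exists_finset_sum_eq_list_sum` — in characteristic two a list sum is a sum over a set of at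
  most `length` elements (so a word of length `≤ 2d` has the string of a SET of `≤ 2d` modes);
* `card_image_erase_le` — hence the strings of all words of length `≤ 2d` on `n` qubits, the
  identity excluded, number at most `Σ_{k=1}^{2d} C(2n, k)`.

No auxiliary definitions: the bit encoding `β : Pauli → ZMod 2 × ZMod 2` and its inverse `π` are
universally quantified and pinned down by hypotheses (instantiated by explicit tables in the main
file `SymplecticPurityGaussianDegreeBound.lean`).
-/

set_option linter.dupNamespace false -- D-0017: single-problem summit ⇒ `QuantumAdvantage.QuantumAdvantage` by design

noncomputable section

namespace Summit.QuantumAdvantage.QuantumAdvantage.Theorems.SymplecticPurity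

open Matrix Finset
open Literature.Computability.QuantumComplexity Literature.Computability.Cryptography

/-! ### The product table: neutral letter and unit phases -/

/-- `I` is a right unit of the letter product. -/
theorem letterMul_I_right (P : Pauli) : P.letterMul Pauli.I = P := by
  cases P <;> rfl

/-- `I` is a left unit of the letter product. -/
theorem letterMul_I_left (P : Pauli) : Pauli.I.letterMul P = P := by
  cases P <;> rfl

/-- Products with `I` on the right carry no phase. -/
theorem letterPhase_I_right (P : Pauli) : P.letterPhase Pauli.I = 1 := by
  cases P <;> rfl

/-- Products with `I` on the left carry no phase. -/
theorem letterPhase_I_left (P : Pauli) : Pauli.I.letterPhase P = 1 := by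
  cases P <;> rfl

/-- The phases of the letter product table are unit complex numbers. -/
theorem norm_letterPhase (P Q : Pauli) : ‖P.letterPhase Q‖ = 1 := by
  cases P <;> cases Q <;> simp [Pauli.letterPhase]

/-- The phase of a product of two Pauli strings is a unit complex number. -/
theorem norm_stringPhase {ι : Type*} [Fintype ι] (P Q : ι → Pauli) : ‖stringPhase P Q‖ = 1 := by
  rw [stringPhase, norm_prod]
  exact Finset.prod_eq_one fun i _ => norm_letterPhase _ _

/-! ### One-wire factors as Majorana words -/

variable {n : ℕ}

/-- Splitting off the letter on wire `j`: `σ_S = σ_{S[j ↦ I]} · σ_{I…I S_j I…I}` (no phase). -/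
theorem pauliString_eq_update_mul_single (S : Fin n → Pauli) (j : Fin n) :
    pauliString S = pauliString (Function.update S j Pauli.I) *
      pauliString (Function.update (fun _ => Pauli.I) j (S j)) := by
  rw [pauliString_mul]
  have h1 : stringMul (Function.update S j Pauli.I) (Function.update (fun _ => Pauli.I) j (S j)) = S := by
    funext i
    by_cases hi : i = j
    · subst hi
      simp [stringMul, letterMul_I_left]
    · simp [stringMul, hi, letterMul_I_right]
  have h2 : stringPhase (Function.update S j Pauli.I) (Function.update (fun _ => Pauli.I) j (S j)) = 1 := by
    refine Finset.prod_eq_one fun i _ => ?_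
    by_cases hi : i = j
    · subst hi
      simp [letterPhase_I_left]
    · simp [hi, letterPhase_I_right]
  rw [h1, h2, one_smul]

/-- `X_j = Z_{<j} · c_{j,X}` and `Y_j = Z_{<j} · c_{j,Y}`: the single-site `X`/`Y` is the `Z`-tail
string below `j` times the Jordan–Wigner Majorana. -/
theorem pauliString_single_XY (j : Fin n) (b : Bool) :
    pauliString (Function.update (fun _ => Pauli.I) j (if b then Pauli.Y else Pauli.X)) =
      pauliString (fun i : Fin n => if i < j then Pauli.Z else Pauli.I) * majorana n j b := by
  rw [majorana, pauliString_mul]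
  have h1 : stringMul (fun i : Fin n => if i < j then Pauli.Z else Pauli.I) (majoranaWord n j b) =
      Function.update (fun _ => Pauli.I) j (if b then Pauli.Y else Pauli.X) := by
    funext i
    rcases lt_trichotomy i j with h | rfl | h
    · rw [Function.update_of_ne (ne_of_lt h)]
      simp only [stringMul, if_pos h, majoranaWord_of_lt n b h]
      rfl
    · rw [Function.update_self]
      simp only [stringMul, lt_irrefl, if_false, majoranaWord_self]
      cases b <;> rfl
    · rw [Function.update_of_ne (ne_of_gt h)]
      simp only [stringMul, if_neg (not_lt.2 h.le), majoranaWord_of_gt n b h]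
      rfl
  have h2 : stringPhase (fun i : Fin n => if i < j then Pauli.Z else Pauli.I) (majoranaWord n j b) = 1 := by
    refine Finset.prod_eq_one fun i _ => ?_
    rcases lt_trichotomy i j with h | rfl | h
    · simp only [if_pos h, majoranaWord_of_lt n b h]
      rfl
    · simp only [lt_irrefl, if_false, majoranaWord_self]
      cases b <;> rfl
    · simp only [if_neg (not_lt.2 h.le), majoranaWord_of_gt n b h]
      rfl
  rw [h1, h2, one_smul]

/-- `c_{j,X} c_{j,Y} = i Z_j`. -/
theorem majorana_false_mul_true (j : Fin n) :
    majorana n j false * majorana n j true =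
      Complex.I • pauliString (Function.update (fun _ => Pauli.I) j Pauli.Z) := by
  rw [majorana, majorana, pauliString_mul]
  have h1 : stringMul (majoranaWord n j false) (majoranaWord n j true) =
      Function.update (fun _ => Pauli.I) j Pauli.Z := by
    funext i
    rcases lt_trichotomy i j with h | rfl | h
    · rw [Function.update_of_ne (ne_of_lt h)]
      simp only [stringMul, majoranaWord_of_lt n _ h]
      rfl
    · rw [Function.update_self]
      simp only [stringMul, majoranaWord_self]
      rfl
    · rw [Function.update_of_ne (ne_of_gt h)]
      simp only [stringMul, majoranaWord_of_gt n _ h]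
      rfl
  have h2 : stringPhase (majoranaWord n j false) (majoranaWord n j true) = Complex.I := by
    rw [stringPhase, Finset.prod_eq_single j]
    · simp only [majoranaWord_self]
      rfl
    · intro i _ hi
      rcases lt_or_gt_of_ne hi with h | h
      · simp only [majoranaWord_of_lt n _ h]
        rfl
      · simp only [majoranaWord_of_gt n _ h]
        rfl
    · simp
  rw [h1, h2]

/-- `Z_j = -i c_{j,X} c_{j,Y}`. -/
theorem pauliString_single_Z (j : Fin n) :
    pauliString (Function.update (fun _ => Pauli.I) j Pauli.Z) =
      (-Complex.I) • (majorana n j false * majorana n j true) := by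
  rw [majorana_false_mul_true, smul_smul]
  simp

/-! ### Strings on the low wires are short Majorana words -/

/-- The word product of a concatenation. -/
theorem word_append (w w' : List (Fin n × Bool)) :
    ((w ++ w').map fun q => majorana n q.1 q.2).prod =
      (w.map fun q => majorana n q.1 q.2).prod * (w'.map fun q => majorana n q.1 q.2).prod := by
  rw [List.map_append, List.prod_append]

/-- **Jordan–Wigner keeps initial blocks local**: a Pauli string supported on the wires `< d` is a
unit phase times a Majorana word of length `≤ 2d` (all of whose letters live on wires `< d`, which
we do not record). Induction on `d`: split off the top letter `σ` on wire `j = d`; `I`: nothing;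
`X`/`Y`: `σ_j = Z_{<j} c_{j,σ}` and `Z_{<j}` is absorbed into the lower string (a string on wires
`< d`, up to a phase) BEFORE the induction hypothesis; `Z`: `Z_j = -i c_{j,X} c_{j,Y}`. -/
theorem exists_word_of_low {d : ℕ} (hd : d ≤ n) :
    ∀ S : Fin n → Pauli, (∀ i : Fin n, d ≤ i.val → S i = Pauli.I) →
      ∃ (w : List (Fin n × Bool)) (c : ℂ), w.length ≤ 2 * d ∧ ‖c‖ = 1 ∧
        pauliString S = c • (w.map fun q => majorana n q.1 q.2).prod := by
  induction d with
  | zero =>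
    intro S hS
    refine ⟨[], 1, le_rfl, norm_one, ?_⟩
    have : S = fun _ => Pauli.I := funext fun i => hS i (Nat.zero_le _)
    rw [this, pauliString_const_I, one_smul, List.map_nil, List.prod_nil]
  | succ d ih =>
    intro S hS
    have hdn : d < n := hd
    set j : Fin n := ⟨d, hdn⟩ with hj
    have ih' := ih hdn.le
    -- the lower string
    have hlow : ∀ i : Fin n, d ≤ i.val → Function.update S j Pauli.I i = Pauli.I := by
      intro i hi
      by_cases hij : i = j
      · rw [hij, Function.update_self]
      · rw [Function.update_of_ne hij]
        refine hS i ?_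
        have : i.val ≠ d := fun h => hij (Fin.ext (by rw [h, hj]))
        omega
    have hsplit := pauliString_eq_update_mul_single S j
    rcases hSj : S j with _ | _ | _ | _
    · -- `I`: the string is already low
      have hself : Function.update S j Pauli.I = S := by rw [← hSj, Function.update_eq_self]
      obtain ⟨w, c, hw, hc, h⟩ := ih' S (by rw [← hself]; exact hlow)
      exact ⟨w, c, by omega, hc, h⟩
    · -- `X`
      have hZlow : ∀ i : Fin n, d ≤ i.val →
          stringMul (Function.update S j Pauli.I) (fun i : Fin n => if i < j then Pauli.Z else Pauli.I) i
            = Pauli.I := by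
        intro i hi
        have hij : ¬ i < j := fun h => by
          have h' : i.val < d := Fin.lt_def.1 h
          omega
        simp only [stringMul, hlow i hi, if_neg hij]
        rfl
      obtain ⟨w, c, hw, hc, h⟩ := ih' _ hZlow
      refine ⟨w ++ [(j, false)], stringPhase (Function.update S j Pauli.I)
        (fun i : Fin n => if i < j then Pauli.Z else Pauli.I) * c, ?_, ?_, ?_⟩
      · rw [List.length_append, List.length_singleton]; omega
      · rw [norm_mul, norm_stringPhase, hc, one_mul]
      · rw [hsplit, hSj, show (Pauli.X : Pauli) = if false then Pauli.Y else Pauli.X from rfl,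
          pauliString_single_XY, ← Matrix.mul_assoc, pauliString_mul, h, word_append,
          List.map_singleton, List.prod_singleton, Matrix.smul_mul, Matrix.smul_mul, smul_smul]
    · -- `Y`
      have hZlow : ∀ i : Fin n, d ≤ i.val →
          stringMul (Function.update S j Pauli.I) (fun i : Fin n => if i < j then Pauli.Z else Pauli.I) i
            = Pauli.I := by
        intro i hi
        have hij : ¬ i < j := fun h => by
          have h' : i.val < d := Fin.lt_def.1 h
          omega
        simp only [stringMul, hlow i hi, if_neg hij]
        rfl
      obtain ⟨w, c, hw, hc, h⟩ := ih' _ hZlow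
      refine ⟨w ++ [(j, true)], stringPhase (Function.update S j Pauli.I)
        (fun i : Fin n => if i < j then Pauli.Z else Pauli.I) * c, ?_, ?_, ?_⟩
      · rw [List.length_append, List.length_singleton]; omega
      · rw [norm_mul, norm_stringPhase, hc, one_mul]
      · rw [hsplit, hSj, show (Pauli.Y : Pauli) = if true then Pauli.Y else Pauli.X from rfl,
          pauliString_single_XY, ← Matrix.mul_assoc, pauliString_mul, h, word_append,
          List.map_singleton, List.prod_singleton, Matrix.smul_mul, Matrix.smul_mul, smul_smul]
    · -- `Z`
      obtain ⟨w, c, hw, hc, h⟩ := ih' _ hlow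
      refine ⟨w ++ [(j, false), (j, true)], c * (-Complex.I), ?_, ?_, ?_⟩
      · rw [List.length_append]; simp only [List.length_cons, List.length_nil]; omega
      · rw [norm_mul, hc, norm_neg, Complex.norm_I, one_mul]
      · rw [hsplit, hSj, pauliString_single_Z, h, word_append, Matrix.smul_mul, Matrix.mul_smul,
          smul_smul]
        simp only [List.map_cons, List.map_nil, List.prod_cons, List.prod_nil, Matrix.mul_one]

/-! ### Words are phased Pauli strings (strings form a group modulo phases) -/

section Bits

variable (β : Pauli → ZMod 2 × ZMod 2) (π : ZMod 2 × ZMod 2 → Pauli)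
  (hπβ : ∀ P, π (β P) = P) (hβπ : ∀ v, β (π v) = v)
  (hmul : ∀ P Q : Pauli, β (P.letterMul Q) = β P + β Q) (hI : β Pauli.I = 0)

include hπβ hβπ hmul in
/-- The letter product read through the bit encoding. -/
theorem letterMul_pi (P : Pauli) (v : ZMod 2 × ZMod 2) : P.letterMul (π v) = π (β P + v) := by
  conv_lhs => rw [← hπβ (P.letterMul (π v)), hmul, hβπ]

include hπβ hβπ hmul hI in
/-- **Every Majorana word is a phased Pauli string** whose bits are the sum of the bits of the
Jordan–Wigner words of its letters: `c_{q₁} ⋯ c_{q_m} = c · σ_{π(Σ_k β(w_{q_k}))}`, `|c| = 1`. -/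
theorem word_eq_smul_pauliString (w : List (Fin n × Bool)) :
    ∃ c : ℂ, ‖c‖ = 1 ∧ (w.map fun q => majorana n q.1 q.2).prod =
      c • pauliString (fun i => π ((w.map fun q => fun i => β (majoranaWord n q.1 q.2 i)).sum i)) := by
  induction w with
  | nil =>
    refine ⟨1, norm_one, ?_⟩
    have h0 : π 0 = Pauli.I := by rw [← hI, hπβ]
    simp only [List.map_nil, List.prod_nil, List.sum_nil, Pi.zero_apply, h0, pauliString_const_I,
      one_smul]
  | cons q w ih =>
    obtain ⟨c, hc, h⟩ := ih
    refine ⟨c * stringPhase (majoranaWord n q.1 q.2)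
      (fun i => π ((w.map fun q => fun i => β (majoranaWord n q.1 q.2 i)).sum i)), ?_, ?_⟩
    · rw [norm_mul, hc, norm_stringPhase, one_mul]
    · rw [List.map_cons, List.prod_cons, h, Matrix.mul_smul, majorana, pauliString_mul, smul_smul]
      congr 2
      funext i
      simp only [stringMul, List.map_cons, List.sum_cons, Pi.add_apply]
      exact letterMul_pi β π hπβ hβπ hmul _ _

end Bits

/-- **List sums in characteristic two are sums over small sets**: if `x + x = 0` for all `x`, then
for every list `l` there is a set `T` of at most `|l|` elements (the elements of odd multiplicity)
with `Σ_{a ∈ l} f a = Σ_{a ∈ T} f a` for EVERY `f`. -/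
theorem exists_finset_sum_eq_list_sum {α M : Type*} [DecidableEq α] [AddCommMonoid M]
    (h2 : ∀ x : M, x + x = 0) :
    ∀ l : List α, ∃ T : Finset α, T.card ≤ l.length ∧ ∀ f : α → M, (l.map f).sum = ∑ a ∈ T, f a
  | [] => ⟨∅, le_rfl, fun f => by simp⟩
  | a :: l => by
    obtain ⟨T, hT, hsum⟩ := exists_finset_sum_eq_list_sum h2 l
    by_cases ha : a ∈ T
    · refine ⟨T.erase a, ?_, fun f => ?_⟩
      · have := Finset.card_erase_lt_of_mem ha
        rw [List.length_cons]
        omega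
      · rw [List.map_cons, List.sum_cons, hsum f, ← Finset.add_sum_erase T f ha, ← add_assoc, h2,
          zero_add]
    · refine ⟨insert a T, ?_, fun f => ?_⟩
      · rw [Finset.card_insert_of_notMem ha, List.length_cons]
        omega
      · rw [List.map_cons, List.sum_cons, hsum f, Finset.sum_insert ha]

/-! ### Counting the strings of short words -/

/-- The number of sets of Majorana modes of size between `1` and `m` on `n` qubits is at most
`Σ_{k=1}^{m} C(2n, k)`. -/
theorem card_filter_card_mem_Icc_le (n m : ℕ) :
    ((Finset.univ : Finset (Finset (Fin n × Bool))).filter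
        (fun T => 1 ≤ T.card ∧ T.card ≤ m)).card ≤
      ∑ k ∈ Finset.Icc 1 m, (2 * n).choose k := by
  classical
  have hsub : (Finset.univ : Finset (Finset (Fin n × Bool))).filter (fun T => 1 ≤ T.card ∧ T.card ≤ m) ⊆
      (Finset.Icc 1 m).biUnion (fun k => Finset.powersetCard k (Finset.univ : Finset (Fin n × Bool))) := by
    intro T hT
    rw [Finset.mem_filter] at hT
    rw [Finset.mem_biUnion]
    exact ⟨T.card, Finset.mem_Icc.2 hT.2, Finset.mem_powersetCard.2 ⟨Finset.subset_univ _, rfl⟩⟩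
  refine (Finset.card_le_card hsub).trans (Finset.card_biUnion_le.trans (le_of_eq ?_))
  refine Finset.sum_congr rfl fun k _ => ?_
  rw [Finset.card_powersetCard, Finset.card_univ, Fintype.card_prod, Fintype.card_fin,
    Fintype.card_bool, mul_comm]

/-- **Counting**: for any map `G` from sets of modes to strings, the images of the sets of size
`≤ m`, with the image of `∅` removed, number at most `Σ_{k=1}^{m} C(2n, k)`. -/
theorem card_image_erase_le (n m : ℕ) (G : Finset (Fin n × Bool) → (Fin n → Pauli)) :
    ((((Finset.univ : Finset (Finset (Fin n × Bool))).filter (fun T => T.card ≤ m)).image G).erase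
        (G ∅)).card ≤
      ∑ k ∈ Finset.Icc 1 m, (2 * n).choose k := by
  classical
  refine le_trans (Finset.card_le_card ?_)
    ((Finset.card_image_le (f := G)).trans (card_filter_card_mem_Icc_le n m))
  intro S hS
  rw [Finset.mem_erase, Finset.mem_image] at hS
  obtain ⟨hne, T, hT, rfl⟩ := hS
  rw [Finset.mem_filter] at hT
  refine Finset.mem_image.2 ⟨T, Finset.mem_filter.2 ⟨Finset.mem_univ _, ?_, hT.2⟩, rfl⟩
  rw [Nat.one_le_iff_ne_zero]
  intro h0
  exact hne (by rw [Finset.card_eq_zero.1 h0])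

end Summit.QuantumAdvantage.QuantumAdvantage.Theorems.SymplecticPurity

end
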